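import Mathlib
import HarnessLib
import Summits.HubbardSuperconductivity.HubbardSuperconductivity.Theorems.KLProgrammeKLRegimeTwoVolumeTowerBaseGridLimitDeg
import Summits.HubbardSuperconductivity.HubbardSuperconductivity.Theorems.KLProgrammeKLRegimeTwoVolumeTowerGenericFacts
import Summits.HubbardSuperconductivity.HubbardSuperconductivity.Theorems.KLProgrammeKLRegimeTwoVolumeTowerDataDefs
import Summits.HubbardSuperconductivity.HubbardSuperconductivity.Theorems.KLProgrammeKLRegimeTwoVolumeTowerTransferWtData
import Summits.HubbardSuperconductivity.HubbardSuperconductivity.Theorems.KLProgrammeKLRegimeTwoVolumeTowerDataOfPartsDeg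
import Summits.HubbardSuperconductivity.HubbardSuperconductivity.Theorems.KLProgrammeKLRegimeTwoVolumeTowerSrcScaledKit
import Summits.HubbardSuperconductivity.HubbardSuperconductivity.Theorems.KLProgrammeKLRegimeTwoVolumeSourceSmoothStateKit

/-!
# [«(VL)-SRC-WINDOW» SW twin (k3c4-p1 g16, filed by g17 under the pen's (R235) «KEY = WINDOW»): `TowerDataTSW` from its parts; base hypothesis = the SMOOTHED truncated defect at `t = 1`]
# Route `KLProgramme` — crux K3, VL child `KLRegimeVolumeLimitV17F2` (stmt-HubbardSuperconductivity-20440), skeleton «cauchy» v11: `TowerDataTSW β U μ t` FROM ITS PARTS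
# WITH THE BASE (H6) AS A HYPOTHESIS (twin of `…TowerTruncOfPartsS.towerDataTS_of_partsD`; seat hubbard-kl-k3c4-p1 g16; `--supports` 20440)

p3 g18's located defect «BASE-SRC-ROWS» (`…TowerBaseSrcBlockRows.not_exists_uniform_srcBlock_rowBound`): the plain source block of the base transfer has
`ℓ¹` rows `≍ (2/π)·ln M`, so the base-transfer bundle `hdataT` (conjuncts 1–2) that `towerDataTS_of_partsD` consumes — via `towerData_h0_canonicalD` — to produce
the base field `h0` has NO `M`-uniform witness.  The field `h0` itself (the keyed two-volume defect of the source-truncated step-`0` states at deep pins tends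
to zero) is untouched; only the transfer-row ROUTE to it is dead.  This twin therefore takes the base as ONE hypothesis `h0T` in its canonical form (truncated
keyed defect `klKeyedDefectT`, canonical radius `r_L = L/(4J+7)`; the rescaled defect is dominated by it, `klKeyedDefectTS_le_klKeyedDefectT`) and keeps
everything else of `towerDataTS_of_partsD` byte-identical; the whole grid-data block (`TowerGridDataD`, its scalars and rates) disappears from the interface.

* **`towerDataTS_of_partsH0`**.

Proofs only; no definition.  Honest framing: a conditional constructor; nothing here asserts `h0T`, any stub, K3, VL or superconductivity.
[cite: BenfattoGiulianiMastropietro2006, §2.7-§2.9 and §3]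
-/

noncomputable section

namespace Summit.HubbardSuperconductivity.HubbardSuperconductivity.Theorems.TwoVolumeSource

set_option linter.dupNamespace false -- summit = problem name (single-conjunct summit), D-0017

open Finset Filter Topology Literature.MathematicalPhysics.QuantumLattice GrassmannAlgebra Literature.Probability.LatticeModels
  Literature.Probability.LatticeModels.BattleFederbush
open Literature.MathematicalPhysics.QuantumLattice.FermiRG
open Summit.HubbardSuperconductivity.HubbardSuperconductivity.Theorems.KLProgrammeLegKernels
open Summit.HubbardSuperconductivity.HubbardSuperconductivity.Theorems.KLRegimeSplit
open Summit.HubbardSuperconductivity.HubbardSuperconductivity.Theorems.TwoPointAssembly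
open Summit.HubbardSuperconductivity.HubbardSuperconductivity.Theorems.EngineV8
open Summit.HubbardSuperconductivity.HubbardSuperconductivity.Theorems.TwoVolumeDefect

/-- **`TowerDataTSW β U μ t` FROM ITS PARTS, grid scaling, `t ∈ [0,1]`** (see the module docstring): fields (H1)–(H5) verbatim, canonical radius, base from the
UNSCALED base data (the rescaled truncated base defect is dominated by it). [folklore] -/
theorem towerDataTSW_of_partsH0 (β U μ : ℝ) {t : ℝ} (ht0 : 0 ≤ t) (ht1 : t ≤ 1) (Mth : ℕ → ℕ → ℕ)
    -- (H1)–(H5): the fields of `TowerData` other than `Mth, r, hr, hRd, h0`, verbatim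
    (Λ : ℕ → ℝ)
    (κ : ℕ → ℝ)
    (aW : ℕ → ℝ)
    (sW : ℕ → ℝ)
    (κ' : ℕ → ℝ)
    (aW' : ℕ → ℝ)
    (sW' : ℕ → ℝ)
    (eW' : ℕ → ℝ)
    (ΛT : ℕ → ℝ)
    (cW : ℕ → ℝ)
    (κf : ℕ → ℝ)
    (cRb : ℕ → ℝ)
    (cCb : ℕ → ℝ)
    (δb : ℕ → ℝ)
    (ρ₀ : ℕ → ℝ)
    (ρf : ℕ → ℝ)
    (ρ₂ : ℕ → ℝ)
    (ρ' : ℕ → ℝ)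
    (ρ₃ : ℕ → ℝ)
    (ν₀ : ℕ → ℝ)
    (ν₁ : ℕ → ℝ)
    (ν₂ : ℕ → ℝ)
    (ν₃ : ℕ → ℝ)
    (ν₄ : ℕ → ℝ)
    (ν₅ : ℕ → ℝ)
    (νE : ℕ → ℝ)
    (ν₆ : ℕ → ℝ)
    (ν₇ : ℕ → ℝ)
    (ν₈ : ℕ → ℝ)
    (NV : ℕ → ℕ → ℝ)
    (NS : ℕ → ℕ → ℝ)
    (sE : ℕ → ℕ → ℝ)
    (cR : ℕ → ℕ → ℝ)
    (cC : ℕ → ℕ → ℝ)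
    (δ : ℕ → ℕ → ℝ)
    (hΛ : ∀ j, 0 < Λ j)
    (hΛmono : ∀ j, Λ (j + 1) ≤ Λ j)
    (hΛT : ∀ j, Λ j ≤ ΛT j)
    (hκ : ∀ j, 0 < κ j ∧ 0 < κ' j ∧ 0 < κf j)
    (haW : ∀ j, 0 ≤ aW j ∧ 0 ≤ aW' j ∧ 0 ≤ sW j ∧ 0 ≤ sW' j ∧ 0 ≤ eW' j ∧ 0 ≤ cW j ∧ 0 ≤ δb j)
    (hρ : ∀ j, 0 < ρ₀ j ∧ 0 < ρf j ∧ 0 < ρ₂ j ∧ 0 < ρ' j ∧ 0 < ρ₃ j)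
    (hNV0 : ∀ j m, 0 ≤ NV j m)
    (hNSnn : ∀ j k, 0 ≤ NS j k)
    (hNS0 : ∀ k, NS 0 k = if Even k then NV 0 (k / 2) else 0)
    (hNSsucc : ∀ j k, j < nScales β → NS (j + 1) k = (ρ₀ j)⁻¹ ^ k * (Real.exp 1 * ν₀ j) / (1 - Real.exp 1 * aW j * ν₀ j / κ j ^ 2))
    (hsm : ∀ j, j < nScales β → TowerScaleSmall (κ j) (κ' j) (aW j) (aW' j) (cW j) (κf j) (cRb j) (cCb j) (δb j) (ρ₀ j) (ρf j) (ρ₂ j) (ρ' j) (ρ₃ j) (NV j) (NS j)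
      (ν₀ j) (ν₁ j) (ν₂ j) (ν₃ j) (ν₄ j) (ν₅ j) (νE j) (ν₆ j) (ν₇ j) (ν₈ j))
    (hmis : ∀ j L, 0 ≤ sE j L ∧ 0 ≤ cR j L ∧ 0 ≤ cC j L ∧ 0 ≤ δ j L ∧ cR j L ≤ cRb j ∧ cC j L ≤ cCb j ∧ δ j L ≤ δb j)
    (hmis0 : ∀ j, Tendsto (sE j) atTop (𝓝 0) ∧ Tendsto (cR j) atTop (𝓝 0) ∧ Tendsto (cC j) atTop (𝓝 0) ∧ Tendsto (δ j) atTop (𝓝 0))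
    (hdata : ∀ᶠ L in atTop, ∀ (b M : ℕ) [NeZero L] [NeZero (b * L)] [NeZero M], Mth L b ≤ M →
      TowerVolumeDataTSW L M β U μ (klFlowFrameU L M β U μ (nScales β + 1)) (nScales β) (imagTimeWeight β M) t Λ κ aW sW NV ∧
      TowerVolumeDataTSW (b * L) M β U μ (klFlowFrameU (b * L) M β U μ (nScales β + 1)) (nScales β) (imagTimeWeight β M) t Λ κ aW sW NV ∧
      TowerCrossData L b M β μ (klFlowFrameU L M β U μ (nScales β + 1)) (klFlowFrameU (b * L) M β U μ (nScales β + 1)) (nScales β) (imagTimeWeight β M)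
      Λ κ' aW' sW' eW' ΛT cW κf (fun j => sE j L) (fun j => cR j L) (fun j => cC j L) (fun j => δ j L))
    -- (H6) the BASE as a hypothesis (located «BASE-SRC-ROWS», p3 g18: the transfer-row route to it is dead; any route may supply it): the TRUNCATED keyed
    -- defect of the step-`0` states at the `2r_L`-deep pins, canonical radius `r_L = L/(4J+7)`, tends to zero uniformly in the instance
    (h0T : ∀ (k : ℕ) (η : ℝ), 0 < η → ∀ᶠ L in atTop, ∀ (b M : ℕ) [NeZero L] [NeZero (b * L)] [NeZero M], Mth L b ≤ M →
      ∀ (p : Fin k) (w : SrcLabel (b * L) M 0),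
        (∀ i, 2 * (L / (4 * nScales β + 7)) ≤ (w.1.1.2 i).val % L ∧ (w.1.1.2 i).val % L + 2 * (L / (4 * nScales β + 7)) < L) →
        klKeyedDefectTSW L b M β U μ (klFlowFrameU L M β U μ (nScales β + 1)) (klFlowFrameU (b * L) M β U μ (nScales β + 1)) 1 0 k p w ≤ imagTimeWeight β M * η)
 :
    Nonempty (TowerDataTSW β U μ t) :=
  ⟨{
    Mth := Mth
    r := fun L => L / (4 * nScales β + 7)
    hr := tower_radius_tendsto β
    hRd := tower_radius_deep β
    Λ := Λ
    κ := κ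
    aW := aW
    sW := sW
    κ' := κ'
    aW' := aW'
    sW' := sW'
    eW' := eW'
    ΛT := ΛT
    cW := cW
    κf := κf
    cRb := cRb
    cCb := cCb
    δb := δb
    ρ₀ := ρ₀
    ρf := ρf
    ρ₂ := ρ₂
    ρ' := ρ'
    ρ₃ := ρ₃
    ν₀ := ν₀
    ν₁ := ν₁
    ν₂ := ν₂
    ν₃ := ν₃
    ν₄ := ν₄
    ν₅ := ν₅
    νE := νE
    ν₆ := ν₆
    ν₇ := ν₇
    ν₈ := ν₈
    NV := NV
    NS := NS
    sE := sE
    cR := cR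
    cC := cC
    δ := δ
    hΛ := hΛ
    hΛmono := hΛmono
    hΛT := hΛT
    hκ := hκ
    haW := haW
    hρ := hρ
    hNV0 := hNV0
    hNSnn := hNSnn
    hNS0 := hNS0
    hNSsucc := hNSsucc
    hsm := hsm
    hmis := hmis
    hmis0 := hmis0
    hdata := hdata
    h0 := fun k η hη => by
      filter_upwards [h0T k η hη] with L hL
      intro b M _ _ _ hM p w hw
      exact (klKeyedDefectTSW_le_one β U μ _ _ ht0 ht1 0 k p w).trans (hL b M hM p w hw) }⟩

end Summit.HubbardSuperconductivity.HubbardSuperconductivity.Theorems.TwoVolumeSource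

end
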